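import Mathlib
import Summits.ValiantsHypothesis.ValiantsHypothesis.Theorems.NewtonUnitEquationsDissociatedUniformQuasiPoly

/-!
# Crux `NewtonUnitEquations.DissociatedUniform` (stmt-ValiantsHypothesis-5905), line `greedy-basis-shadow` —
# stub `stub_subframeCount` (torus frames: the greedy words of a cell embed into the shadow of a sub-frame)

Setting: a frame `A : Fin m → Finset ℕ²` with coefficient polynomials `f i j`, the chart heights
`h_λ b = ε · Xf b + λ · Yf b` (`λ ∈ Λ`), a reference word `τ`, a coordinate set `P` and sub-alphabets `B j ⊆ A j`
containing `τ j` with `|B j| ≤ T`.  Hypothesis `hwords`: every word that is lex-greedy for an injective `h_λ`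
(`λ ∈ Λ`) agrees with `τ` off `P` and uses letters of `B j` only.  Conclusion: there are at most
`(T + 2) · (8 (k + 2)³)^⌈log₂ |P|⌉` such words.

Proof.  Reindex `P` by `Fin n` (`n = |P|`) and form the sub-frame `A' i = B (ι i)`, `f' r i = f r (ι i)`.  The
restriction `res a = a ∘ ι` is injective on the words in question (they are `τ` off `P`), and it maps them into the
frame shadow `QuasiPoly.fshadow A' f'`: the extension `ext a'` (by `τ` off `P`) satisfies
`col f (ext a') = c ⊙ col f' a'` with the constant vector `c r = ∏_{j ∉ P} coeff (τ j) (f r j)` and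
`h_λ (ext a') = lin Xf Yf (ε, λ) a' + C_λ` with a constant `C_λ`, so injectivity of the height descends to the
sub-box and a linear relation among sub-frame columns of strictly higher words is mapped by the linear map
`v ↦ c ⊙ v` to a relation among frame columns of strictly higher words (no nonvanishing of `c` is needed).
Theorem Q's shadow bound `QuasiPoly.ncard_fshadow_le` on the sub-frame finishes. [folklore]
-/

open scoped BigOperators

-- Sub = Summit single-conjunct layout: the duplicated namespace component is mandated by the tree.
set_option linter.dupNamespace false

namespace Summit.ValiantsHypothesis.ValiantsHypothesis.Theorems.NewtonUnitEquationsDissociatedUniform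

/-- **Sub-frame count** (registered stub `stub_subframeCount` of line `greedy-basis-shadow`).  If every word that is
lex-greedy for an injective chart height `b ↦ ε · Xf b + λ · Yf b` (`λ ∈ Λ`) agrees with the reference word `τ` off
the coordinate set `P` and only uses letters from sub-alphabets `B j ∋ τ j` of size `≤ T`, then there are at most
`(T + 2) · (8 (k + 2)³)^⌈log₂ |P|⌉` such words: restriction to `P` embeds them into the frame shadow of the sub-frame
`(B ∘ ι, f ∘ ι)` on `Fin |P|` (columns agree up to the constant factor `∏_{j ∉ P} coeff (τ j) (f r j)`, heights up to
an additive constant), and Theorem Q's shadow bound applies. [folklore] -/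
theorem stub_subframeCount (k m T : ℕ) (A : Fin m → Finset (Fin 2 →₀ ℕ))
    (f : Fin k → Fin m → MvPolynomial (Fin 2) ℂ) (ε : ℝ) (Λ : Set ℝ) (τ : Fin m → (Fin 2 →₀ ℕ))
    (P : Finset (Fin m)) (B : Fin m → Finset (Fin 2 →₀ ℕ))
    (hBA : ∀ j, B j ⊆ A j) (hτB : ∀ j, τ j ∈ B j)
    (hBcard : ∀ j, (B j).card ≤ T)
    (hwords : ∀ lam ∈ Λ, ∀ a : Fin m → (Fin 2 →₀ ℕ),
      Set.InjOn (fun b : Fin m → (Fin 2 →₀ ℕ) => ε * QuasiPoly.Xf b + lam * QuasiPoly.Yf b) (Fintype.piFinset A) →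
      a ∈ QuasiPoly.gE (Fintype.piFinset A) (QuasiPoly.col f)
        (fun b : Fin m → (Fin 2 →₀ ℕ) => ε * QuasiPoly.Xf b + lam * QuasiPoly.Yf b) →
      (∀ j, j ∉ P → a j = τ j) ∧ (∀ j, a j ∈ B j)) :
    {a : Fin m → (Fin 2 →₀ ℕ) | ∃ lam ∈ Λ,
        Set.InjOn (fun b : Fin m → (Fin 2 →₀ ℕ) => ε * QuasiPoly.Xf b + lam * QuasiPoly.Yf b) (Fintype.piFinset A) ∧
        a ∈ QuasiPoly.gE (Fintype.piFinset A) (QuasiPoly.col f)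
          (fun b : Fin m → (Fin 2 →₀ ℕ) => ε * QuasiPoly.Xf b + lam * QuasiPoly.Yf b)}.ncard ≤
      (T + 2) * (8 * (k + 2) ^ 3) ^ Nat.clog 2 P.card := by
  classical
  obtain ⟨n, hn⟩ : ∃ n, P.card = n := ⟨_, rfl⟩
  rw [hn]
  set W : Set (Fin m → (Fin 2 →₀ ℕ)) := {a : Fin m → (Fin 2 →₀ ℕ) | ∃ lam ∈ Λ,
        Set.InjOn (fun b : Fin m → (Fin 2 →₀ ℕ) => ε * QuasiPoly.Xf b + lam * QuasiPoly.Yf b) (Fintype.piFinset A) ∧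
        a ∈ QuasiPoly.gE (Fintype.piFinset A) (QuasiPoly.col f)
          (fun b : Fin m → (Fin 2 →₀ ℕ) => ε * QuasiPoly.Xf b + lam * QuasiPoly.Yf b)} with hW
  -- reindex `P` by `Fin n`
  set e : Fin n ≃o ↥P := P.orderIsoOfFin hn with he
  set ι : Fin n → Fin m := fun i => (e i : Fin m) with hι
  have hιP : ∀ i, ι i ∈ P := fun i => (e i).2
  have hreidx_prod : ∀ g : Fin m → ℂ, ∏ j ∈ P, g j = ∏ i, g (ι i) := by
    intro g
    rw [← Finset.prod_coe_sort P]
    exact (Fintype.prod_equiv e.toEquiv (fun i => g (ι i)) (fun j => g j) fun _ => rfl).symm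
  have hreidx_sum : ∀ g : Fin m → ℝ, ∑ j ∈ P, g j = ∑ i, g (ι i) := by
    intro g
    rw [← Finset.sum_coe_sort P]
    exact (Fintype.sum_equiv e.toEquiv (fun i => g (ι i)) (fun j => g j) fun _ => rfl).symm
  -- the sub-frame
  set A' : Fin n → Finset (Fin 2 →₀ ℕ) := fun i => B (ι i) with hA'
  set f' : Fin k → Fin n → MvPolynomial (Fin 2) ℂ := fun r i => f r (ι i) with hf'
  have hcard' : ∀ i, (A' i).card ≤ T := fun i => hBcard (ι i)
  -- restriction and extension
  set res : (Fin m → (Fin 2 →₀ ℕ)) → (Fin n → (Fin 2 →₀ ℕ)) := fun a i => a (ι i) with hres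
  set ext : (Fin n → (Fin 2 →₀ ℕ)) → (Fin m → (Fin 2 →₀ ℕ)) := fun a' j =>
    if h : j ∈ P then a' (e.symm ⟨j, h⟩) else τ j with hext
  have hext_on : ∀ a' i, ext a' (ι i) = a' i := by
    intro a' i
    have h1 : (⟨ι i, hιP i⟩ : ↥P) = e i := Subtype.ext rfl
    simp only [hext, dif_pos (hιP i), h1, OrderIso.symm_apply_apply]
  have hext_off : ∀ a' j, j ∉ P → ext a' j = τ j := fun a' j hj => by simp only [hext, dif_neg hj]
  have hres_ext : ∀ a', res (ext a') = a' := fun a' => funext fun i => hext_on a' i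
  have hext_res : ∀ a : Fin m → (Fin 2 →₀ ℕ), (∀ j, j ∉ P → a j = τ j) → ext (res a) = a := by
    intro a ha
    funext j
    by_cases hj : j ∈ P
    · have h1 : ι (e.symm ⟨j, hj⟩) = j := by
        simp only [hι, OrderIso.apply_symm_apply]
      simp only [hext, dif_pos hj, hres, h1]
    · rw [hext_off _ j hj, ha j hj]
  have hext_box : ∀ a', a' ∈ Fintype.piFinset A' → ext a' ∈ Fintype.piFinset A := by
    intro a' ha'
    rw [Fintype.mem_piFinset] at ha' ⊢
    intro j
    by_cases hj : j ∈ P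
    · have h1 : ι (e.symm ⟨j, hj⟩) = j := by
        simp only [hι, OrderIso.apply_symm_apply]
      have h2 := ha' (e.symm ⟨j, hj⟩)
      simp only [hA', h1] at h2
      simp only [hext, dif_pos hj]
      exact hBA j h2
    · rw [hext_off _ j hj]
      exact hBA j (hτB j)
  -- (i) columns: `col f (ext a') = c * col f' a'`
  set c : Fin k → ℂ := fun r => ∏ j ∈ Pᶜ, (f r j).coeff (τ j) with hc
  have hcol : ∀ a', QuasiPoly.col f (ext a') = c * QuasiPoly.col f' a' := by
    intro a'
    funext r
    simp only [QuasiPoly.col, Pi.mul_apply, hc, hf']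
    rw [← Finset.prod_mul_prod_compl P (fun j => (f r j).coeff (ext a' j)), mul_comm]
    congr 1
    · exact Finset.prod_congr rfl fun j hj => by rw [hext_off a' j (Finset.mem_compl.mp hj)]
    · rw [hreidx_prod]
      exact Finset.prod_congr rfl fun i _ => by rw [hext_on]
  -- (ii) heights: `h_λ (ext a') = lin Xf Yf (ε, λ) a' + C_λ`
  have hpt : ∀ {p : ℕ} (b : Fin p → (Fin 2 →₀ ℕ)) (s : Fin 2),
      ((((∑ j, b j) s : ℕ)) : ℝ) = ∑ j, ((((b j) s : ℕ)) : ℝ) := by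
    intro p b s
    simp only [Finsupp.coe_finsetSum, Finset.sum_apply, Nat.cast_sum]
  have hXext : ∀ a' (s : Fin 2), ((((∑ j, ext a' j) s : ℕ)) : ℝ) =
      ((((∑ i, a' i) s : ℕ)) : ℝ) + ∑ j ∈ Pᶜ, ((((τ j) s : ℕ)) : ℝ) := by
    intro a' s
    rw [hpt, hpt, ← Finset.sum_add_sum_compl P]
    congr 1
    · rw [hreidx_sum]
      exact Finset.sum_congr rfl fun i _ => by rw [hext_on]
    · exact Finset.sum_congr rfl fun j hj => by rw [hext_off a' j (Finset.mem_compl.mp hj)]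
  have hh : ∀ (lam : ℝ) a', ε * QuasiPoly.Xf (ext a') + lam * QuasiPoly.Yf (ext a') =
      QuasiPoly.lin QuasiPoly.Xf QuasiPoly.Yf ![ε, lam] a' +
        (ε * ∑ j ∈ Pᶜ, ((((τ j) 0 : ℕ)) : ℝ) + lam * ∑ j ∈ Pᶜ, ((((τ j) 1 : ℕ)) : ℝ)) := by
    intro lam a'
    simp only [QuasiPoly.lin, QuasiPoly.Xf, QuasiPoly.Yf, Matrix.cons_val_zero, Matrix.cons_val_one, hXext]
    ring
  -- main inclusion: `res '' W ⊆ fshadow A' f'`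
  have hsub : res '' W ⊆ QuasiPoly.fshadow A' f' := by
    rintro _ ⟨a, ⟨lam, hlam, hinj, ha⟩, rfl⟩
    obtain ⟨hoff, hB⟩ := hwords lam hlam a hinj ha
    have hresA : res a ∈ Fintype.piFinset A' := Fintype.mem_piFinset.mpr fun i => hB (ι i)
    have hexta : ext (res a) = a := hext_res a hoff
    refine ⟨![ε, lam], ?_, ?_⟩
    · -- injectivity of the height on the sub-box
      intro b' hb' b'' hb'' hbb
      have hb'A : ext b' ∈ (Fintype.piFinset A : Set (Fin m → (Fin 2 →₀ ℕ))) :=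
        Finset.mem_coe.mpr (hext_box b' (Finset.mem_coe.mp hb'))
      have hb''A : ext b'' ∈ (Fintype.piFinset A : Set (Fin m → (Fin 2 →₀ ℕ))) :=
        Finset.mem_coe.mpr (hext_box b'' (Finset.mem_coe.mp hb''))
      have hexteq : ext b' = ext b'' := by
        refine hinj hb'A hb''A ?_
        show ε * QuasiPoly.Xf (ext b') + lam * QuasiPoly.Yf (ext b') =
          ε * QuasiPoly.Xf (ext b'') + lam * QuasiPoly.Yf (ext b'')
        rw [hh, hh, hbb]
      rw [← hres_ext b', ← hres_ext b'', hexteq]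
    · -- greediness on the sub-frame
      refine ⟨hresA, fun hmem => ha.2 ?_⟩
      have h1 := Submodule.apply_mem_span_image_of_mem_span (LinearMap.mulLeft ℂ c) hmem
      rw [LinearMap.mulLeft_apply, ← hcol, hexta, ← Set.image_comp] at h1
      refine Submodule.span_mono ?_ h1
      rintro _ ⟨b', ⟨hb', hlt⟩, rfl⟩
      refine ⟨ext b', ⟨hext_box b' hb', ?_⟩, ?_⟩
      · show ε * QuasiPoly.Xf a + lam * QuasiPoly.Yf a < ε * QuasiPoly.Xf (ext b') + lam * QuasiPoly.Yf (ext b')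
        rw [← hexta, hh, hh]
        linarith
      · show QuasiPoly.col f (ext b') = c * QuasiPoly.col f' b'
        rw [hcol]
  -- `res` is injective on `W`
  have hinjres : Set.InjOn res W := by
    rintro a ⟨lam, hlam, hinj, ha⟩ b ⟨lam', hlam', hinj', hb⟩ hab
    rw [← hext_res a (hwords lam hlam a hinj ha).1, ← hext_res b (hwords lam' hlam' b hinj' hb).1, hab]
  calc W.ncard = (res '' W).ncard := hinjres.ncard_image.symm
    _ ≤ (QuasiPoly.fshadow A' f').ncard := Set.ncard_le_ncard hsub (QuasiPoly.cshadow_finite _ _ _ _)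
    _ ≤ (T + 2) * (8 * (k + 2) ^ 3) ^ Nat.clog 2 n := QuasiPoly.ncard_fshadow_le n k T A' f' hcard'

end Summit.ValiantsHypothesis.ValiantsHypothesis.Theorems.NewtonUnitEquationsDissociatedUniform
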